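import Summits.CriticalPhenomena.SAWScalingLimit.Theorems.SAWMassiveIsingTiltLatticeUniversalityAdmissibleTipsBulk
import HarnessLib

/-!
# `AdmissibleTips` (line `registered` = `birth` v4.3, crux `LatticeUniversality`,
# stmt-CriticalPhenomena-0807)

Stub `stub_admissibleTips` of the line `registered` for the crux
`Summit.CriticalPhenomena.SAWScalingLimit.Theses.SAWMassiveIsingTilt.LatticeUniversality`
(stmt-CriticalPhenomena-0807): **a bulk-attached boundary mid-edge approximation of the face sets of
the rotated, half-shifted domains `S_δ(D) = σD − iδ/2` whose boundary-triangle TIPS are an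
admissible hexagonal endpoint approximation of `D` itself.** For every Dobrushin domain
`D = (Ω; a, b)` there are mid-edges `a'_δ ≠ b'_δ` of Glazman–Manolescu's hexagonal point `Θ ≡ π/3`
which, for all small `δ > 0`, are boundary edges of `(S_δ Ω)_δ = meshFaces (π/3) (S_δ Ω) δ` joined
by a Yang–Baxter walk, with `δ a'_δ → σ a`, `δ b'_δ → σ b` (`σ z = i z`), AND whose tips
`bdryVertex (S_δ Ω)_δ a'_δ`, `bdryVertex (S_δ Ω)_δ b'_δ` (the honeycomb vertices of the triangles
of the rhombi of `(S_δ Ω)_δ` resting on `a'_δ, b'_δ`) satisfy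
`IsEmbEndpointApprox hexGraph hexCenter D`: for all small `δ` they are joined in the vertex
discretisation `Ω_δ ⊆ δℍ` of `Ω` (its largest honeycomb mesh component), and
`δ · hexCenter (tip) → a`, resp. `b`.

Proof. The construction of `stub_shiftedBdryEndpoints` (p147051,
`ShiftedEndpoints.exists_bdry_threshold_translate`) is redone with ONE FIXED interior point
`z₀ = i x₀` of `σΩ` added to the compact set `{z, w, z₀}` fed to the bulk lemma
(`exists_bdry_threshold_anchor`): the boundary rhombi found near `σ a + t`, `σ b + t` (`t = −iδ/2`)
are then joined, by chains of side-adjacent rhombi of `(S_δ Ω)_δ`, to the ANCHOR rhombus of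
`(z₀ + t)/δ`. By the `π/3` dictionary (`embMeshVertexGraph_reachable_of_walk`,
`gmFace_bdryVertex`) the two tips and the triangle `triWN` of the anchor rhombus are joined in the
honeycomb mesh graph of the face domain `faceDomain (S_δ Ω) δ a'_δ ⊆ Ω`
(`faceDomain_shifted_subset_carrier`), hence in the honeycomb mesh graph of `Ω`
(`embMeshGraph_adj_mono`). The anchor triangle's mesh point is within `4δ` of the FIXED point
`x₀ ∈ Ω` (`dist_hexCenter_triWN_anchor_lt`: `S_δ⁻¹` is an isometry carrying `δ · rhombus`
onto the `ψ_δ`-square containing `δ · hexCenter`), so it lies in the largest mesh component of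
`Ω` for small `δ` (`HexEndpointApprox.exists_forall_mem_hexMeshDomain_and_reachable` with the
compact `closedBall x₀ r₀ ⊆ Ω`), which drags both tips into that component
(`reachable_embDomainGraph_of_walk`). Tip positions: `δ · hexCenter (bdryVertex Δ e)` is within
`4δ` of `S_δ⁻¹ (δ · planeMidpoint e)` for every face set `Δ` (`dist_hexCenter_bdryVertex_le`), and
`S_δ⁻¹ w_δ = −i w_δ + δ/2 → −i σ a = a` when `w_δ → σ a` (`tendsto_hexCenter_bdryVertex`).
Elementary; tagged [folklore].
-/

noncomputable section

namespace Summit.CriticalPhenomena.SAWScalingLimit.Cruxes.LatticeUniversality.Birth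

open MeasureTheory Filter Topology Set Metric
open scoped NNReal ENNReal BoundedContinuousFunction
open Complex (I I_ne_zero)
open Literature.Probability.RandomPlanarGeometry
open Literature.Probability.RandomPlanarGeometry.SAW
open Literature.Probability.RandomPlanarGeometry.SAW.YangBaxter
open Literature.Probability.LatticeModels (Site HexVertex hexGraph hexCenter)
open Summit.CriticalPhenomena.SAWScalingLimit.Theses
open Summit.CriticalPhenomena.SAWScalingLimit.Cruxes.HexTransfer.YbRelay (third IsBdryEdge bdryVertex
  faceDomain gmSimilarity stub_gmHexDictionary)
open Summit.CriticalPhenomena.SAWScalingLimit.Cruxes.HexTransfer.YbRelay (triWN inclFace faceAdj)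
open Summit.CriticalPhenomena.SAWScalingLimit.Theorems.HexEndpointApprox
  (exists_forall_mem_hexMeshDomain_and_reachable)

open AdmissibleTips ShiftedEndpoints in
/-- **Stub `stub_admissibleTips`** (line `registered` v4.3, crux `LatticeUniversality`,
stmt-CriticalPhenomena-0807): for every Dobrushin domain `D` there are mid-edges `(a', b')`,
eventually distinct boundary edges of the face sets of the moving domains `S_δ(D) = σD − iδ/2`
joined by a Glazman–Manolescu walk, with rescaled midpoints converging to the marked points of
`σD`, whose boundary-triangle tips form an admissible hexagonal endpoint approximation of `D`
itself (`IsEmbEndpointApprox hexGraph hexCenter D`). Interior points `z_n → σ a`, `w_n → σ b` of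
`σD`, a fixed anchor `x₀ ∈ D` with `closedBall x₀ r₀ ⊆ D`; anchored stage thresholds
`exists_bdry_threshold_anchor` at `t = −iδ/2`; diagonal stage selection
`exists_stage_tendsto_atTop`; distinctness by Hausdorff separation of `σ a ≠ σ b`; tips joined
in `D_δ` by `reachable_bdryVertex_of_anchor` once `δ < δ₀ (closedBall x₀ r₀)`
(`exists_forall_mem_hexMeshDomain_and_reachable`) and `4δ < r₀`; tip limits by
`tendsto_hexCenter_bdryVertex` and `−i σ a = a`. [folklore] -/
theorem stub_admissibleTips : ∀ D : DobrushinDomain, ∃ a' b' : ℝ → MidEdge, (∀ᶠ δ in 𝓝[>] (0 : ℝ), a' δ ≠ b' δ ∧ IsBdryEdge (meshFaces third (((D.map (similarity I I_ne_zero 0)).map (similarity 1 one_ne_zero (-(I * (δ : ℂ) / 2)))).carrier) δ) (a' δ) ∧ IsBdryEdge (meshFaces third (((D.map (similarity I I_ne_zero 0)).map (similarity 1 one_ne_zero (-(I * (δ : ℂ) / 2)))).carrier) δ) (b' δ) ∧ Nonempty (YangBaxterSAW third (((D.map (similarity I I_ne_zero 0)).map (similarity 1 one_ne_zero (-(I *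 (δ : ℂ) / 2)))).carrier) δ (a' δ) (b' δ))) ∧ Tendsto (fun δ : ℝ => (δ : ℂ) * planeMidpoint third (a' δ)) (𝓝[>] (0 : ℝ)) (𝓝 ((D.map (similarity I I_ne_zero 0)).pt 0)) ∧ Tendsto (fun δ : ℝ => (δ : ℂ) * planeMidpoint third (b' δ)) (𝓝[>] (0 : ℝ)) (𝓝 ((D.map (similarity I I_ne_zero 0)).pt 1)) ∧ SAW.IsEmbEndpointApprox hexGraph hexCenter D (fun δ => (bdryVertex (meshFaces third (((D.map (similarity I I_ne_zero 0)).map (similarity 1 one_ne_zero (-(I * (δ : ℂ) / 2)))).carrier) δ) (a' δ))) (fun δ => (bdryVertex (meshFaces third (((D.map (similarity I I_ne_zero 0)).map (similarity 1 one_ne_zero (-(I * (δ : ℂ) / 2)))).carrier) δ) (b' δ))) := by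
  classical
  intro D
  -- tips joined in `D_δ` (stated before `σD` is abbreviated)
  have hkey : ∀ {δ : ℝ}, 0 < δ → ∀ {a b : MidEdge} {f₀ : Face},
      IsBdryEdge (meshFaces third (((D.map (similarity I I_ne_zero 0)).map
        (similarity 1 one_ne_zero (-(I * (δ : ℂ) / 2)))).carrier) δ) a →
      (faceAdj (meshFaces third (((D.map (similarity I I_ne_zero 0)).map
        (similarity 1 one_ne_zero (-(I * (δ : ℂ) / 2)))).carrier) δ)).Reachable f₀
        (inclFace (meshFaces third (((D.map (similarity I I_ne_zero 0)).map
          (similarity 1 one_ne_zero (-(I * (δ : ℂ) / 2)))).carrier) δ) a) →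
      (faceAdj (meshFaces third (((D.map (similarity I I_ne_zero 0)).map
        (similarity 1 one_ne_zero (-(I * (δ : ℂ) / 2)))).carrier) δ)).Reachable f₀
        (inclFace (meshFaces third (((D.map (similarity I I_ne_zero 0)).map
          (similarity 1 one_ne_zero (-(I * (δ : ℂ) / 2)))).carrier) δ) b) →
      triWN f₀ ∈ embMeshDomain hexGraph hexCenter D.carrier δ →
      (embDomainGraph hexGraph hexCenter D.carrier δ).Reachable
        (bdryVertex (meshFaces third (((D.map (similarity I I_ne_zero 0)).map
          (similarity 1 one_ne_zero (-(I * (δ : ℂ) / 2)))).carrier) δ) a)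
        (bdryVertex (meshFaces third (((D.map (similarity I I_ne_zero 0)).map
          (similarity 1 one_ne_zero (-(I * (δ : ℂ) / 2)))).carrier) δ) b) :=
    fun hδ _ _ _ ha hfa hfb hu₀ => reachable_bdryVertex_of_anchor D hδ ha hfa hfb hu₀
  have h0 : -I * (D.map (similarity I I_ne_zero 0)).pt 0 = D.pt 0 := by
    rw [MarkedDomain.pt_map, similarity_apply, add_zero, ← mul_assoc,
      show -I * I = 1 by rw [neg_mul, Complex.I_mul_I, neg_neg], one_mul]
  have h1 : -I * (D.map (similarity I I_ne_zero 0)).pt 1 = D.pt 1 := by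
    rw [MarkedDomain.pt_map, similarity_apply, add_zero, ← mul_assoc,
      show -I * I = 1 by rw [neg_mul, Complex.I_mul_I, neg_neg], one_mul]
  -- the rotated domain `σD`
  set E : DobrushinDomain := D.map (similarity I I_ne_zero 0) with hE
  -- interior points `z i n → E.pt i`
  have hz : ∀ (i : Fin 2) (n : ℕ), ∃ z ∈ E.carrier, dist z (E.pt i) < 1 / ((n : ℝ) + 1) := by
    intro i n
    obtain ⟨z, hz, hd⟩ := Metric.mem_closure_iff.1
      (frontier_subset_closure (E.pt_mem_frontier i)) (1 / ((n : ℝ) + 1)) (by positivity)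
    exact ⟨z, hz, by rwa [dist_comm]⟩
  choose z hzΩ hzd using hz
  have hpt : ∀ i : Fin 2, E.pt i ∉ E.carrier := fun i h => by
    have hf := E.pt_mem_frontier i
    rw [frontier, E.isOpen.interior_eq] at hf
    exact hf.2 h
  -- the anchor `x₀ ∈ D`, a closed disc about it inside `D`, and `z₀ = i x₀ ∈ σD`
  obtain ⟨x₀, hx₀⟩ := D.toJordanDomain.nonempty
  obtain ⟨r₀, hr₀, hr₀Ω⟩ : ∃ r > (0 : ℝ), closedBall x₀ r ⊆ D.carrier := by
    obtain ⟨r, hr, hsub⟩ := Metric.isOpen_iff.1 D.isOpen x₀ hx₀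
    exact ⟨r / 2, by positivity, (closedBall_subset_ball (by linarith)).trans hsub⟩
  have hz₀ : I * x₀ ∈ E.carrier := by
    rw [hE, MarkedDomain.carrier_map]
    exact ⟨x₀, hx₀, by simp⟩
  -- anchored stage thresholds and the diagonal stage selection
  have hst := fun n => exists_bdry_threshold_anchor E (hzΩ 0 n) (hzΩ 1 n) hz₀ (hpt 0) (hpt 1)
  choose ε hε hgood using hst
  choose a b hab using hgood
  obtain ⟨N, hN, hNtop⟩ := exists_stage_tendsto_atTop (p := fun n δ => 0 < δ ∧ δ < ε n)
    (ε := ε) hε (fun n δ h₁ h₂ => ⟨h₁, h₂⟩)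
  have hgoodN := hN.mono fun δ h => hab (N δ) δ (-(I * (δ : ℂ) / 2)) h.1 h.2 (norm_halfShift_le h.1)
  -- the rescaled midpoints converge to the marked points of `σD`
  have hta : Tendsto (fun δ : ℝ => (δ : ℂ) * planeMidpoint third (a (N δ) δ (-(I * (δ : ℂ) / 2))))
      (𝓝[>] (0 : ℝ)) (𝓝 (E.pt 0)) :=
    tendsto_of_eventually_dist_le_five (hgoodN.mono fun δ h => h.2.2.2.1) (hzd 0) hNtop
  have htb : Tendsto (fun δ : ℝ => (δ : ℂ) * planeMidpoint third (b (N δ) δ (-(I * (δ : ℂ) / 2))))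
      (𝓝[>] (0 : ℝ)) (𝓝 (E.pt 1)) :=
    tendsto_of_eventually_dist_le_five (hgoodN.mono fun δ h => h.2.2.2.2.1) (hzd 1) hNtop
  -- the two approximations are eventually distinct, as `E.pt 0 ≠ E.pt 1`
  have hne : ∀ᶠ δ in 𝓝[>] (0 : ℝ),
      a (N δ) δ (-(I * (δ : ℂ) / 2)) ≠ b (N δ) δ (-(I * (δ : ℂ) / 2)) := by
    have h01 : E.pt 0 ≠ E.pt 1 := fun h => absurd (E.pt_injective h) (by decide)
    obtain ⟨U, W, hU, hW, hpU, hpW, hUW⟩ := t2_separation h01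
    filter_upwards [hta.eventually_mem (hU.mem_nhds hpU), htb.eventually_mem (hW.mem_nhds hpW)]
      with δ ha hb hab'
    rw [hab'] at ha
    exact Set.disjoint_left.1 hUW ha hb
  -- the largest honeycomb mesh component of `D` swallows the disc about the anchor
  obtain ⟨δ₁, hδ₁, hbulk⟩ := exists_forall_mem_hexMeshDomain_and_reachable D.toJordanDomain
    (isCompact_closedBall x₀ r₀) hr₀Ω
  have hreach : ∀ᶠ δ in 𝓝[>] (0 : ℝ), (embDomainGraph hexGraph hexCenter D.carrier δ).Reachable
      (bdryVertex (meshFaces third ((E.map (similarity 1 one_ne_zero (-(I * (δ : ℂ) / 2)))).carrier) δ)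
        (a (N δ) δ (-(I * (δ : ℂ) / 2))))
      (bdryVertex (meshFaces third ((E.map (similarity 1 one_ne_zero (-(I * (δ : ℂ) / 2)))).carrier) δ)
        (b (N δ) δ (-(I * (δ : ℂ) / 2)))) := by
    filter_upwards [hgoodN, Ioo_mem_nhdsGT (lt_min hδ₁ (show (0 : ℝ) < r₀ / 4 by positivity))]
      with δ hg hδI
    obtain ⟨haI, -, -, -, -, hfa, hfb⟩ := hg
    have hδ : 0 < δ := hδI.1
    have hδ₁' : δ < δ₁ := hδI.2.trans_le (min_le_left _ _)
    have hδr : δ < r₀ / 4 := hδI.2.trans_le (min_le_right _ _)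
    refine hkey hδ haI hfa hfb ((hbulk δ hδ hδ₁').1 _ ?_)
    rw [mem_closedBall]
    have h := dist_hexCenter_triWN_anchor_lt hδ ((I * x₀ + -(I * (δ : ℂ) / 2)) / δ)
    rw [symm_mul_anchor hδ.ne' x₀] at h
    linarith
  refine ⟨fun δ => a (N δ) δ (-(I * (δ : ℂ) / 2)), fun δ => b (N δ) δ (-(I * (δ : ℂ) / 2)), ?_,
    hta, htb, ⟨hreach, ?_, ?_⟩⟩
  · filter_upwards [hne, hgoodN] with δ h₁ h₂
    exact ⟨h₁, h₂.1, h₂.2.1, h₂.2.2.1⟩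
  · have h := tendsto_hexCenter_bdryVertex
      (Δ := fun δ => meshFaces third ((E.map (similarity 1 one_ne_zero (-(I * (δ : ℂ) / 2)))).carrier) δ)
      hta
    rwa [h0] at h
  · have h := tendsto_hexCenter_bdryVertex
      (Δ := fun δ => meshFaces third ((E.map (similarity 1 one_ne_zero (-(I * (δ : ℂ) / 2)))).carrier) δ)
      htb
    rwa [h1] at h

end Summit.CriticalPhenomena.SAWScalingLimit.Cruxes.LatticeUniversality.Birth

end
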